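import Summits.Ventures.CertifiedManyBodySolver.Rows.TorusCeilingHomSpinTwistTTPrimeCoord
import Summits.Ventures.CertifiedManyBodySolver.Rows.TorusCeilingTTPrimeHom
import Summits.Ventures.CertifiedManyBodySolver.Rows.TorusCeilingCRTSeam
import HarnessLib

/-!
# Spin-twisted `t–t'` torus ceiling V — the CRT carriers `3 × 4`, `3 × 5` (twist and seam form)

HONEST FRAMING: first certified bounds; not a superconductivity verdict; every number certified or
labelled float.
The rows of the CAL `t' ≠ 0` jobs on the rectangular carriers, in their CRT ring presentations
`crtHom34 / crtHom43` (`ℤ/12`) and `crtHom35 / crtHom53` (`ℤ/15`) of `Rows/TorusCeilingCRT.lean`: for every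
uniform spin twist `κ : Fin 2 → Fin 2 → U(1)` (`crt..SpinTwistTT'_…`) and for every spin-blind seam pair
`η ∈ U(1)²` in the exact-diagonalisation convention (`crtSeam`, nearest neighbours; the INDUCED diagonal
table `diagPathTable`, diagonals: a diagonal hop picks up every seam phase it crosses — e.g. the rows
`3x5_AP_tp-0.25_…`) the `t–t'` window certificate bounds the energy density in EVERY sector `(N↑, N↓)`
(`crt..SeamTT'_…`), density rows at the mean filling. Inputs: the every-sector theorem of Part III, the
non-degeneracy of the nearest-neighbour and diagonal Cayley graphs (`crtHom.._comp_diagMap`,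
`injective_signedHop_ringHom`), window injectivity from coordinate spreads (`injOn_ringHom_two_of_spread`)
and the CRT coordinate gauge (`homGaugeTransform_crtGauge_crtHom..`). Kernel item K8 of the CAL ceiling page
(rectangular carriers). [cite: ShastrySutherland1990] [cite: Gros1992] [cite: Han2020Bootstrap, §3]
[cite: XuEtAl2024, eq. (1)] [cite: Lieb1994, eq. (1)]
-/

noncomputable section

open Matrix Finset
open Literature.MathematicalPhysics.QuantumLattice
open Literature.MathematicalPhysics.QuantumFieldTheory hiding Site
open Literature.MathematicalPhysics.QuantumManyBody.StateRelaxation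
open Literature.Probability.LatticeModels
open HubbardWave0
open scoped ComplexOrder ComplexConjugate

namespace Summit.Ventures.CertifiedManyBodySolver.Rows

section CRTSpinTwistTTPrime

variable {d' N : ℕ}

/-- **Spin-blind dictionary for gauges**: a species-independent gauge acting on a species-independent bond
table is the orbital gauge transform of Part VI, species by species. [cite: Lieb1994, eq. (1)] -/
theorem homSpinGaugeTransform_spinBlind (φ : Site 2 →+ TorusSite d' N) (g : TorusSite d' N → Circle)
    (A : TorusSite d' N → Fin 2 → Circle) :
    homSpinGaugeTransform φ (fun x _ => g x) (fun x i _ => A x i) = fun x i _ => homGaugeTransform φ g A x i :=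
  rfl

/-- **Spin-twisted `3 × 4` `t–t'` torus (`crtHom34`), every `U(1)↑ × U(1)↓` twist, every sector
`(N↑, N↓)`** (coordinate spreads of `Λ'` at most `2` resp. `3`; `thicken Λ 1 ⊆ Λ'`), density rows at the
mean filling `(a + b)/24`. [cite: ShastrySutherland1990] [cite: Han2020Bootstrap, §3] [cite: XuEtAl2024, eq. (1)] -/
theorem crt34SpinTwistTT'_minEnergyOn_upDownSector_div_ge_of_window_certificate (t t' U : ℝ)
    (κt : Fin 2 → Fin 2 → Circle)
    {nu nd : ℕ} (hnu : nu ≤ Fintype.card (FermionTorus 1 12)) (hnd : nd ≤ Fintype.card (FermionTorus 1 12))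
    {Λ Λ' : Finset (Site 2)} (hΛ : Λ ⊆ Λ')
    (hspread : ∀ x ∈ Λ', ∀ y ∈ Λ', |x 0 - y 0| ≤ (2 : ℤ) ∧ |x 1 - y 1| ≤ (3 : ℤ))
    (h8 : thicken Λ 1 ⊆ Λ') (h0 : thicken ({0} : Finset (Site 2)) 1 ⊆ Λ') (hz : (0 : Site 2) ∈ Λ')
    (μ : Fin 2 → ℝ) (ν : ℝ)
    {m : Type*} [Fintype m] [DecidableEq m] {Λm : Matrix m m ℂ} (hΛm : Λm.PosSemidef)
    (O : m → FermionOp Λ')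
    {κ : Type*} (s : Finset κ) (B : κ → FermionOp Λ)
    {ι : Type*} (tt : Finset ι) (v : ι → Site 2) (hsh : ∀ l, shiftSet (v l) Λ ⊆ Λ') (Y : ι → FermionOp Λ)
    {γ : Type*} (u : Finset γ) (b : γ → ℂ) (cw : γ → List (Orb (PolySite Λ') × Bool))
    (hcw : ∀ j ∈ u, ladderCharge (cw j) ≠ 0 ∨ ladderSpinCharge (cw j) ≠ 0)
    {δ : Type*} (ah : Finset δ) (dc : δ → ℝ) (V : δ → FermionOp Λ')
    {κ'' : Type*} (w : Finset κ'') (a : κ'' → ℂ) (word : κ'' → List (Orb (PolySite Λ') × Bool)) {c : ℝ}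
    (hcert : fermionEmbed (PolySite.incl h0) ((hubbardTTPrimeFermionInteraction t t' U).meanEnergyObs 1) -
        (c : ℂ) • (1 : FermionOp Λ') -
        ∑ σ : Fin 2, ((μ σ : ℝ) : ℂ) • (nAt 0 hz σ - ((ν : ℝ) : ℂ) • (1 : FermionOp Λ')) =
      gramForm Λm O +
        (∑ k ∈ s, ((hubbardTTPrimeFermionInteraction t t' U).localHamiltonian Λ' * fermionEmbed (PolySite.incl hΛ) (B k) -
            fermionEmbed (PolySite.incl hΛ) (B k) * (hubbardTTPrimeFermionInteraction t t' U).localHamiltonian Λ') +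
          ∑ l ∈ tt, (fermionEmbed (PolySite.incl (hsh l)) (fermionEmbed (PolySite.shiftEmb (v l) Λ) (Y l)) -
            fermionEmbed (PolySite.incl hΛ) (Y l)) +
          ∑ j ∈ u, b j • ladderWord (cw j)) +
        (∑ m' ∈ ah, ((dc m' : ℝ) : ℂ) • ((V m')ᴴ - V m') + ∑ k ∈ w, a k • ladderWord (word k))) :
    c - ∑ k ∈ w, ‖a k‖ + (∑ σ : Fin 2, μ σ) * (((nu : ℝ) + nd) / 2 / 12 - ν) ≤
      (homHubbardSpinMagTT' crtHom34 κt t t' U).minEnergyOn (szSector (nu + nd) (((nu : ℝ) - nd) / 2)) / 12 := by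
  have hInj' : Set.InjOn crtHom34 ↑Λ' :=
    injOn_ringHom_two_of_spread 12 ![4, 9] (M₀ := 2) (M₁ := 3)
      (fun a' b' h₁ h₂ h₃ h₄ h₅ => by
        simp only [Matrix.cons_val_zero, Matrix.cons_val_one] at h₅
        omega) hspread
  have hd : Function.Injective (signedHop crtHom34) := injective_signedHop_ringHom 12 ![4, 9] (by decide)
  have hd' : Function.Injective (signedHop (crtHom34.comp diagMap)) := by
    rw [crtHom34_comp_diagMap]
    exact injective_signedHop_ringHom 12 ![13, -5] (by decide)
  have h := homTorusSpinTwistTT'_minEnergyOn_upDownSector_div_ge_of_window_certificate_avg crtHom34 t t' U κt hd hd'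
    hnu hnd hΛ h8 h0 hz hInj' μ ν hΛm O s B tt v hsh Y u b cw hcw ah dc V w a word hcert
  simp only [Nat.cast_ofNat, pow_one] at h
  exact h

/-- **`3 × 4` `t–t'` torus (`crtHom34`) in SEAM form, every seam pair `η ∈ U(1)²`, every sector** — the
rows as computed: nearest-neighbour seam table `crtSeam 12 3 4 η` (phase `η₀` on the `x`-hops leaving the
last column, `η₁` on the `y`-hops leaving the last row) and the induced diagonal table. Same data and
conclusion as `crt34SpinTwistTT'_minEnergyOn_upDownSector_div_ge_of_window_certificate`.
[cite: Gros1992] [cite: ShastrySutherland1990] [cite: Han2020Bootstrap, §3] [cite: XuEtAl2024, eq. (1)] -/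
theorem crt34SeamTT'_minEnergyOn_upDownSector_div_ge_of_window_certificate (t t' U : ℝ) (η : Fin 2 → Circle)
    {nu nd : ℕ} (hnu : nu ≤ Fintype.card (FermionTorus 1 12)) (hnd : nd ≤ Fintype.card (FermionTorus 1 12))
    {Λ Λ' : Finset (Site 2)} (hΛ : Λ ⊆ Λ')
    (hspread : ∀ x ∈ Λ', ∀ y ∈ Λ', |x 0 - y 0| ≤ (2 : ℤ) ∧ |x 1 - y 1| ≤ (3 : ℤ))
    (h8 : thicken Λ 1 ⊆ Λ') (h0 : thicken ({0} : Finset (Site 2)) 1 ⊆ Λ') (hz : (0 : Site 2) ∈ Λ')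
    (μ : Fin 2 → ℝ) (ν : ℝ)
    {m : Type*} [Fintype m] [DecidableEq m] {Λm : Matrix m m ℂ} (hΛm : Λm.PosSemidef)
    (O : m → FermionOp Λ')
    {κ : Type*} (s : Finset κ) (B : κ → FermionOp Λ)
    {ι : Type*} (tt : Finset ι) (v : ι → Site 2) (hsh : ∀ l, shiftSet (v l) Λ ⊆ Λ') (Y : ι → FermionOp Λ)
    {γ : Type*} (u : Finset γ) (b : γ → ℂ) (cw : γ → List (Orb (PolySite Λ') × Bool))
    (hcw : ∀ j ∈ u, ladderCharge (cw j) ≠ 0 ∨ ladderSpinCharge (cw j) ≠ 0)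
    {δ : Type*} (ah : Finset δ) (dc : δ → ℝ) (V : δ → FermionOp Λ')
    {κ'' : Type*} (w : Finset κ'') (a : κ'' → ℂ) (word : κ'' → List (Orb (PolySite Λ') × Bool)) {c : ℝ}
    (hcert : fermionEmbed (PolySite.incl h0) ((hubbardTTPrimeFermionInteraction t t' U).meanEnergyObs 1) -
        (c : ℂ) • (1 : FermionOp Λ') -
        ∑ σ : Fin 2, ((μ σ : ℝ) : ℂ) • (nAt 0 hz σ - ((ν : ℝ) : ℂ) • (1 : FermionOp Λ')) =
      gramForm Λm O +
        (∑ k ∈ s, ((hubbardTTPrimeFermionInteraction t t' U).localHamiltonian Λ' * fermionEmbed (PolySite.incl hΛ) (B k) -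
            fermionEmbed (PolySite.incl hΛ) (B k) * (hubbardTTPrimeFermionInteraction t t' U).localHamiltonian Λ') +
          ∑ l ∈ tt, (fermionEmbed (PolySite.incl (hsh l)) (fermionEmbed (PolySite.shiftEmb (v l) Λ) (Y l)) -
            fermionEmbed (PolySite.incl hΛ) (Y l)) +
          ∑ j ∈ u, b j • ladderWord (cw j)) +
        (∑ m' ∈ ah, ((dc m' : ℝ) : ℂ) • ((V m')ᴴ - V m') + ∑ k ∈ w, a k • ladderWord (word k))) :
    c - ∑ k ∈ w, ‖a k‖ + (∑ σ : Fin 2, μ σ) * (((nu : ℝ) + nd) / 2 / 12 - ν) ≤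
      (homHubbardSpinMagTT'Gen crtHom34 (fun x i _ => crtSeam 12 3 4 η x i)
          (diagPathTable crtHom34 (fun x i _ => crtSeam 12 3 4 η x i)) t t' U).minEnergyOn
        (szSector (nu + nd) (((nu : ℝ) - nd) / 2)) / 12 := by
  obtain ⟨κ', hκ⟩ := exists_pow_pair_eq_circle η (a := 3) (b := 4) (by norm_num) (by norm_num)
  have hseam : (fun (x : TorusSite 1 12) (i : Fin 2) (_ : Fin 2) => crtSeam 12 3 4 η x i) =
      homSpinGaugeTransform crtHom34 (fun x _ => crtGauge 12 3 4 κ' x) (fun _ i _ => κ' i) := by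
    rw [← hκ, ← homGaugeTransform_crtGauge_crtHom34]
    rfl
  rw [hseam, minEnergyOn_szSector_homHubbardSpinMagTT'Gen_seam_gauge]
  exact crt34SpinTwistTT'_minEnergyOn_upDownSector_div_ge_of_window_certificate t t' U (fun i _ => κ' i) hnu hnd hΛ
    hspread h8 h0 hz μ ν hΛm O s B tt v hsh Y u b cw hcw ah dc V w a word hcert

/-- **Spin-twisted `3 × 5` `t–t'` torus (`crtHom35`), every `U(1)↑ × U(1)↓` twist, every sector
`(N↑, N↓)`** (coordinate spreads of `Λ'` at most `2` resp. `4`; `thicken Λ 1 ⊆ Λ'`), density rows at the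
mean filling `(a + b)/30`. [cite: ShastrySutherland1990] [cite: Han2020Bootstrap, §3] [cite: XuEtAl2024, eq. (1)] -/
theorem crt35SpinTwistTT'_minEnergyOn_upDownSector_div_ge_of_window_certificate (t t' U : ℝ)
    (κt : Fin 2 → Fin 2 → Circle)
    {nu nd : ℕ} (hnu : nu ≤ Fintype.card (FermionTorus 1 15)) (hnd : nd ≤ Fintype.card (FermionTorus 1 15))
    {Λ Λ' : Finset (Site 2)} (hΛ : Λ ⊆ Λ')
    (hspread : ∀ x ∈ Λ', ∀ y ∈ Λ', |x 0 - y 0| ≤ (2 : ℤ) ∧ |x 1 - y 1| ≤ (4 : ℤ))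
    (h8 : thicken Λ 1 ⊆ Λ') (h0 : thicken ({0} : Finset (Site 2)) 1 ⊆ Λ') (hz : (0 : Site 2) ∈ Λ')
    (μ : Fin 2 → ℝ) (ν : ℝ)
    {m : Type*} [Fintype m] [DecidableEq m] {Λm : Matrix m m ℂ} (hΛm : Λm.PosSemidef)
    (O : m → FermionOp Λ')
    {κ : Type*} (s : Finset κ) (B : κ → FermionOp Λ)
    {ι : Type*} (tt : Finset ι) (v : ι → Site 2) (hsh : ∀ l, shiftSet (v l) Λ ⊆ Λ') (Y : ι → FermionOp Λ)
    {γ : Type*} (u : Finset γ) (b : γ → ℂ) (cw : γ → List (Orb (PolySite Λ') × Bool))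
    (hcw : ∀ j ∈ u, ladderCharge (cw j) ≠ 0 ∨ ladderSpinCharge (cw j) ≠ 0)
    {δ : Type*} (ah : Finset δ) (dc : δ → ℝ) (V : δ → FermionOp Λ')
    {κ'' : Type*} (w : Finset κ'') (a : κ'' → ℂ) (word : κ'' → List (Orb (PolySite Λ') × Bool)) {c : ℝ}
    (hcert : fermionEmbed (PolySite.incl h0) ((hubbardTTPrimeFermionInteraction t t' U).meanEnergyObs 1) -
        (c : ℂ) • (1 : FermionOp Λ') -
        ∑ σ : Fin 2, ((μ σ : ℝ) : ℂ) • (nAt 0 hz σ - ((ν : ℝ) : ℂ) • (1 : FermionOp Λ')) =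
      gramForm Λm O +
        (∑ k ∈ s, ((hubbardTTPrimeFermionInteraction t t' U).localHamiltonian Λ' * fermionEmbed (PolySite.incl hΛ) (B k) -
            fermionEmbed (PolySite.incl hΛ) (B k) * (hubbardTTPrimeFermionInteraction t t' U).localHamiltonian Λ') +
          ∑ l ∈ tt, (fermionEmbed (PolySite.incl (hsh l)) (fermionEmbed (PolySite.shiftEmb (v l) Λ) (Y l)) -
            fermionEmbed (PolySite.incl hΛ) (Y l)) +
          ∑ j ∈ u, b j • ladderWord (cw j)) +
        (∑ m' ∈ ah, ((dc m' : ℝ) : ℂ) • ((V m')ᴴ - V m') + ∑ k ∈ w, a k • ladderWord (word k))) :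
    c - ∑ k ∈ w, ‖a k‖ + (∑ σ : Fin 2, μ σ) * (((nu : ℝ) + nd) / 2 / 15 - ν) ≤
      (homHubbardSpinMagTT' crtHom35 κt t t' U).minEnergyOn (szSector (nu + nd) (((nu : ℝ) - nd) / 2)) / 15 := by
  have hInj' : Set.InjOn crtHom35 ↑Λ' :=
    injOn_ringHom_two_of_spread 15 ![10, 6] (M₀ := 2) (M₁ := 4)
      (fun a' b' h₁ h₂ h₃ h₄ h₅ => by
        simp only [Matrix.cons_val_zero, Matrix.cons_val_one] at h₅
        omega) hspread
  have hd : Function.Injective (signedHop crtHom35) := injective_signedHop_ringHom 15 ![10, 6] (by decide)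
  have hd' : Function.Injective (signedHop (crtHom35.comp diagMap)) := by
    rw [crtHom35_comp_diagMap]
    exact injective_signedHop_ringHom 15 ![16, 4] (by decide)
  have h := homTorusSpinTwistTT'_minEnergyOn_upDownSector_div_ge_of_window_certificate_avg crtHom35 t t' U κt hd hd'
    hnu hnd hΛ h8 h0 hz hInj' μ ν hΛm O s B tt v hsh Y u b cw hcw ah dc V w a word hcert
  simp only [Nat.cast_ofNat, pow_one] at h
  exact h

/-- **`3 × 5` `t–t'` torus (`crtHom35`) in SEAM form, every seam pair `η ∈ U(1)²`, every sector** — the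
rows as computed: nearest-neighbour seam table `crtSeam 15 3 5 η` (phase `η₀` on the `x`-hops leaving the
last column, `η₁` on the `y`-hops leaving the last row) and the induced diagonal table. Same data and
conclusion as `crt35SpinTwistTT'_minEnergyOn_upDownSector_div_ge_of_window_certificate`.
[cite: Gros1992] [cite: ShastrySutherland1990] [cite: Han2020Bootstrap, §3] [cite: XuEtAl2024, eq. (1)] -/
theorem crt35SeamTT'_minEnergyOn_upDownSector_div_ge_of_window_certificate (t t' U : ℝ) (η : Fin 2 → Circle)
    {nu nd : ℕ} (hnu : nu ≤ Fintype.card (FermionTorus 1 15)) (hnd : nd ≤ Fintype.card (FermionTorus 1 15))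
    {Λ Λ' : Finset (Site 2)} (hΛ : Λ ⊆ Λ')
    (hspread : ∀ x ∈ Λ', ∀ y ∈ Λ', |x 0 - y 0| ≤ (2 : ℤ) ∧ |x 1 - y 1| ≤ (4 : ℤ))
    (h8 : thicken Λ 1 ⊆ Λ') (h0 : thicken ({0} : Finset (Site 2)) 1 ⊆ Λ') (hz : (0 : Site 2) ∈ Λ')
    (μ : Fin 2 → ℝ) (ν : ℝ)
    {m : Type*} [Fintype m] [DecidableEq m] {Λm : Matrix m m ℂ} (hΛm : Λm.PosSemidef)
    (O : m → FermionOp Λ')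
    {κ : Type*} (s : Finset κ) (B : κ → FermionOp Λ)
    {ι : Type*} (tt : Finset ι) (v : ι → Site 2) (hsh : ∀ l, shiftSet (v l) Λ ⊆ Λ') (Y : ι → FermionOp Λ)
    {γ : Type*} (u : Finset γ) (b : γ → ℂ) (cw : γ → List (Orb (PolySite Λ') × Bool))
    (hcw : ∀ j ∈ u, ladderCharge (cw j) ≠ 0 ∨ ladderSpinCharge (cw j) ≠ 0)
    {δ : Type*} (ah : Finset δ) (dc : δ → ℝ) (V : δ → FermionOp Λ')
    {κ'' : Type*} (w : Finset κ'') (a : κ'' → ℂ) (word : κ'' → List (Orb (PolySite Λ') × Bool)) {c : ℝ}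
    (hcert : fermionEmbed (PolySite.incl h0) ((hubbardTTPrimeFermionInteraction t t' U).meanEnergyObs 1) -
        (c : ℂ) • (1 : FermionOp Λ') -
        ∑ σ : Fin 2, ((μ σ : ℝ) : ℂ) • (nAt 0 hz σ - ((ν : ℝ) : ℂ) • (1 : FermionOp Λ')) =
      gramForm Λm O +
        (∑ k ∈ s, ((hubbardTTPrimeFermionInteraction t t' U).localHamiltonian Λ' * fermionEmbed (PolySite.incl hΛ) (B k) -
            fermionEmbed (PolySite.incl hΛ) (B k) * (hubbardTTPrimeFermionInteraction t t' U).localHamiltonian Λ') +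
          ∑ l ∈ tt, (fermionEmbed (PolySite.incl (hsh l)) (fermionEmbed (PolySite.shiftEmb (v l) Λ) (Y l)) -
            fermionEmbed (PolySite.incl hΛ) (Y l)) +
          ∑ j ∈ u, b j • ladderWord (cw j)) +
        (∑ m' ∈ ah, ((dc m' : ℝ) : ℂ) • ((V m')ᴴ - V m') + ∑ k ∈ w, a k • ladderWord (word k))) :
    c - ∑ k ∈ w, ‖a k‖ + (∑ σ : Fin 2, μ σ) * (((nu : ℝ) + nd) / 2 / 15 - ν) ≤
      (homHubbardSpinMagTT'Gen crtHom35 (fun x i _ => crtSeam 15 3 5 η x i)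
          (diagPathTable crtHom35 (fun x i _ => crtSeam 15 3 5 η x i)) t t' U).minEnergyOn
        (szSector (nu + nd) (((nu : ℝ) - nd) / 2)) / 15 := by
  obtain ⟨κ', hκ⟩ := exists_pow_pair_eq_circle η (a := 3) (b := 5) (by norm_num) (by norm_num)
  have hseam : (fun (x : TorusSite 1 15) (i : Fin 2) (_ : Fin 2) => crtSeam 15 3 5 η x i) =
      homSpinGaugeTransform crtHom35 (fun x _ => crtGauge 15 3 5 κ' x) (fun _ i _ => κ' i) := by
    rw [← hκ, ← homGaugeTransform_crtGauge_crtHom35]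
    rfl
  rw [hseam, minEnergyOn_szSector_homHubbardSpinMagTT'Gen_seam_gauge]
  exact crt35SpinTwistTT'_minEnergyOn_upDownSector_div_ge_of_window_certificate t t' U (fun i _ => κ' i) hnu hnd hΛ
    hspread h8 h0 hz μ ν hΛm O s B tt v hsh Y u b cw hcw ah dc V w a word hcert

/-- **Spin-twisted `4 × 3` `t–t'` torus (`crtHom43`), every `U(1)↑ × U(1)↓` twist, every sector
`(N↑, N↓)`** (coordinate spreads of `Λ'` at most `3` resp. `2`; `thicken Λ 1 ⊆ Λ'`), density rows at the
mean filling `(a + b)/24`. [cite: ShastrySutherland1990] [cite: Han2020Bootstrap, §3] [cite: XuEtAl2024, eq. (1)] -/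
theorem crt43SpinTwistTT'_minEnergyOn_upDownSector_div_ge_of_window_certificate (t t' U : ℝ)
    (κt : Fin 2 → Fin 2 → Circle)
    {nu nd : ℕ} (hnu : nu ≤ Fintype.card (FermionTorus 1 12)) (hnd : nd ≤ Fintype.card (FermionTorus 1 12))
    {Λ Λ' : Finset (Site 2)} (hΛ : Λ ⊆ Λ')
    (hspread : ∀ x ∈ Λ', ∀ y ∈ Λ', |x 0 - y 0| ≤ (3 : ℤ) ∧ |x 1 - y 1| ≤ (2 : ℤ))
    (h8 : thicken Λ 1 ⊆ Λ') (h0 : thicken ({0} : Finset (Site 2)) 1 ⊆ Λ') (hz : (0 : Site 2) ∈ Λ')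
    (μ : Fin 2 → ℝ) (ν : ℝ)
    {m : Type*} [Fintype m] [DecidableEq m] {Λm : Matrix m m ℂ} (hΛm : Λm.PosSemidef)
    (O : m → FermionOp Λ')
    {κ : Type*} (s : Finset κ) (B : κ → FermionOp Λ)
    {ι : Type*} (tt : Finset ι) (v : ι → Site 2) (hsh : ∀ l, shiftSet (v l) Λ ⊆ Λ') (Y : ι → FermionOp Λ)
    {γ : Type*} (u : Finset γ) (b : γ → ℂ) (cw : γ → List (Orb (PolySite Λ') × Bool))
    (hcw : ∀ j ∈ u, ladderCharge (cw j) ≠ 0 ∨ ladderSpinCharge (cw j) ≠ 0)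
    {δ : Type*} (ah : Finset δ) (dc : δ → ℝ) (V : δ → FermionOp Λ')
    {κ'' : Type*} (w : Finset κ'') (a : κ'' → ℂ) (word : κ'' → List (Orb (PolySite Λ') × Bool)) {c : ℝ}
    (hcert : fermionEmbed (PolySite.incl h0) ((hubbardTTPrimeFermionInteraction t t' U).meanEnergyObs 1) -
        (c : ℂ) • (1 : FermionOp Λ') -
        ∑ σ : Fin 2, ((μ σ : ℝ) : ℂ) • (nAt 0 hz σ - ((ν : ℝ) : ℂ) • (1 : FermionOp Λ')) =
      gramForm Λm O +
        (∑ k ∈ s, ((hubbardTTPrimeFermionInteraction t t' U).localHamiltonian Λ' * fermionEmbed (PolySite.incl hΛ) (B k) -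
            fermionEmbed (PolySite.incl hΛ) (B k) * (hubbardTTPrimeFermionInteraction t t' U).localHamiltonian Λ') +
          ∑ l ∈ tt, (fermionEmbed (PolySite.incl (hsh l)) (fermionEmbed (PolySite.shiftEmb (v l) Λ) (Y l)) -
            fermionEmbed (PolySite.incl hΛ) (Y l)) +
          ∑ j ∈ u, b j • ladderWord (cw j)) +
        (∑ m' ∈ ah, ((dc m' : ℝ) : ℂ) • ((V m')ᴴ - V m') + ∑ k ∈ w, a k • ladderWord (word k))) :
    c - ∑ k ∈ w, ‖a k‖ + (∑ σ : Fin 2, μ σ) * (((nu : ℝ) + nd) / 2 / 12 - ν) ≤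
      (homHubbardSpinMagTT' crtHom43 κt t t' U).minEnergyOn (szSector (nu + nd) (((nu : ℝ) - nd) / 2)) / 12 := by
  have hInj' : Set.InjOn crtHom43 ↑Λ' :=
    injOn_ringHom_two_of_spread 12 ![9, 4] (M₀ := 3) (M₁ := 2)
      (fun a' b' h₁ h₂ h₃ h₄ h₅ => by
        simp only [Matrix.cons_val_zero, Matrix.cons_val_one] at h₅
        omega) hspread
  have hd : Function.Injective (signedHop crtHom43) := injective_signedHop_ringHom 12 ![9, 4] (by decide)
  have hd' : Function.Injective (signedHop (crtHom43.comp diagMap)) := by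
    rw [crtHom43_comp_diagMap]
    exact injective_signedHop_ringHom 12 ![13, 5] (by decide)
  have h := homTorusSpinTwistTT'_minEnergyOn_upDownSector_div_ge_of_window_certificate_avg crtHom43 t t' U κt hd hd'
    hnu hnd hΛ h8 h0 hz hInj' μ ν hΛm O s B tt v hsh Y u b cw hcw ah dc V w a word hcert
  simp only [Nat.cast_ofNat, pow_one] at h
  exact h

/-- **`4 × 3` `t–t'` torus (`crtHom43`) in SEAM form, every seam pair `η ∈ U(1)²`, every sector** — the
rows as computed: nearest-neighbour seam table `crtSeam 12 4 3 η` (phase `η₀` on the `x`-hops leaving the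
last column, `η₁` on the `y`-hops leaving the last row) and the induced diagonal table. Same data and
conclusion as `crt43SpinTwistTT'_minEnergyOn_upDownSector_div_ge_of_window_certificate`.
[cite: Gros1992] [cite: ShastrySutherland1990] [cite: Han2020Bootstrap, §3] [cite: XuEtAl2024, eq. (1)] -/
theorem crt43SeamTT'_minEnergyOn_upDownSector_div_ge_of_window_certificate (t t' U : ℝ) (η : Fin 2 → Circle)
    {nu nd : ℕ} (hnu : nu ≤ Fintype.card (FermionTorus 1 12)) (hnd : nd ≤ Fintype.card (FermionTorus 1 12))
    {Λ Λ' : Finset (Site 2)} (hΛ : Λ ⊆ Λ')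
    (hspread : ∀ x ∈ Λ', ∀ y ∈ Λ', |x 0 - y 0| ≤ (3 : ℤ) ∧ |x 1 - y 1| ≤ (2 : ℤ))
    (h8 : thicken Λ 1 ⊆ Λ') (h0 : thicken ({0} : Finset (Site 2)) 1 ⊆ Λ') (hz : (0 : Site 2) ∈ Λ')
    (μ : Fin 2 → ℝ) (ν : ℝ)
    {m : Type*} [Fintype m] [DecidableEq m] {Λm : Matrix m m ℂ} (hΛm : Λm.PosSemidef)
    (O : m → FermionOp Λ')
    {κ : Type*} (s : Finset κ) (B : κ → FermionOp Λ)
    {ι : Type*} (tt : Finset ι) (v : ι → Site 2) (hsh : ∀ l, shiftSet (v l) Λ ⊆ Λ') (Y : ι → FermionOp Λ)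
    {γ : Type*} (u : Finset γ) (b : γ → ℂ) (cw : γ → List (Orb (PolySite Λ') × Bool))
    (hcw : ∀ j ∈ u, ladderCharge (cw j) ≠ 0 ∨ ladderSpinCharge (cw j) ≠ 0)
    {δ : Type*} (ah : Finset δ) (dc : δ → ℝ) (V : δ → FermionOp Λ')
    {κ'' : Type*} (w : Finset κ'') (a : κ'' → ℂ) (word : κ'' → List (Orb (PolySite Λ') × Bool)) {c : ℝ}
    (hcert : fermionEmbed (PolySite.incl h0) ((hubbardTTPrimeFermionInteraction t t' U).meanEnergyObs 1) -
        (c : ℂ) • (1 : FermionOp Λ') -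
        ∑ σ : Fin 2, ((μ σ : ℝ) : ℂ) • (nAt 0 hz σ - ((ν : ℝ) : ℂ) • (1 : FermionOp Λ')) =
      gramForm Λm O +
        (∑ k ∈ s, ((hubbardTTPrimeFermionInteraction t t' U).localHamiltonian Λ' * fermionEmbed (PolySite.incl hΛ) (B k) -
            fermionEmbed (PolySite.incl hΛ) (B k) * (hubbardTTPrimeFermionInteraction t t' U).localHamiltonian Λ') +
          ∑ l ∈ tt, (fermionEmbed (PolySite.incl (hsh l)) (fermionEmbed (PolySite.shiftEmb (v l) Λ) (Y l)) -
            fermionEmbed (PolySite.incl hΛ) (Y l)) +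
          ∑ j ∈ u, b j • ladderWord (cw j)) +
        (∑ m' ∈ ah, ((dc m' : ℝ) : ℂ) • ((V m')ᴴ - V m') + ∑ k ∈ w, a k • ladderWord (word k))) :
    c - ∑ k ∈ w, ‖a k‖ + (∑ σ : Fin 2, μ σ) * (((nu : ℝ) + nd) / 2 / 12 - ν) ≤
      (homHubbardSpinMagTT'Gen crtHom43 (fun x i _ => crtSeam 12 4 3 η x i)
          (diagPathTable crtHom43 (fun x i _ => crtSeam 12 4 3 η x i)) t t' U).minEnergyOn
        (szSector (nu + nd) (((nu : ℝ) - nd) / 2)) / 12 := by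
  obtain ⟨κ', hκ⟩ := exists_pow_pair_eq_circle η (a := 4) (b := 3) (by norm_num) (by norm_num)
  have hseam : (fun (x : TorusSite 1 12) (i : Fin 2) (_ : Fin 2) => crtSeam 12 4 3 η x i) =
      homSpinGaugeTransform crtHom43 (fun x _ => crtGauge 12 4 3 κ' x) (fun _ i _ => κ' i) := by
    rw [← hκ, ← homGaugeTransform_crtGauge_crtHom43]
    rfl
  rw [hseam, minEnergyOn_szSector_homHubbardSpinMagTT'Gen_seam_gauge]
  exact crt43SpinTwistTT'_minEnergyOn_upDownSector_div_ge_of_window_certificate t t' U (fun i _ => κ' i) hnu hnd hΛ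
    hspread h8 h0 hz μ ν hΛm O s B tt v hsh Y u b cw hcw ah dc V w a word hcert

/-- **Spin-twisted `5 × 3` `t–t'` torus (`crtHom53`), every `U(1)↑ × U(1)↓` twist, every sector
`(N↑, N↓)`** (coordinate spreads of `Λ'` at most `4` resp. `2`; `thicken Λ 1 ⊆ Λ'`), density rows at the
mean filling `(a + b)/30`. [cite: ShastrySutherland1990] [cite: Han2020Bootstrap, §3] [cite: XuEtAl2024, eq. (1)] -/
theorem crt53SpinTwistTT'_minEnergyOn_upDownSector_div_ge_of_window_certificate (t t' U : ℝ)
    (κt : Fin 2 → Fin 2 → Circle)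
    {nu nd : ℕ} (hnu : nu ≤ Fintype.card (FermionTorus 1 15)) (hnd : nd ≤ Fintype.card (FermionTorus 1 15))
    {Λ Λ' : Finset (Site 2)} (hΛ : Λ ⊆ Λ')
    (hspread : ∀ x ∈ Λ', ∀ y ∈ Λ', |x 0 - y 0| ≤ (4 : ℤ) ∧ |x 1 - y 1| ≤ (2 : ℤ))
    (h8 : thicken Λ 1 ⊆ Λ') (h0 : thicken ({0} : Finset (Site 2)) 1 ⊆ Λ') (hz : (0 : Site 2) ∈ Λ')
    (μ : Fin 2 → ℝ) (ν : ℝ)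
    {m : Type*} [Fintype m] [DecidableEq m] {Λm : Matrix m m ℂ} (hΛm : Λm.PosSemidef)
    (O : m → FermionOp Λ')
    {κ : Type*} (s : Finset κ) (B : κ → FermionOp Λ)
    {ι : Type*} (tt : Finset ι) (v : ι → Site 2) (hsh : ∀ l, shiftSet (v l) Λ ⊆ Λ') (Y : ι → FermionOp Λ)
    {γ : Type*} (u : Finset γ) (b : γ → ℂ) (cw : γ → List (Orb (PolySite Λ') × Bool))
    (hcw : ∀ j ∈ u, ladderCharge (cw j) ≠ 0 ∨ ladderSpinCharge (cw j) ≠ 0)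
    {δ : Type*} (ah : Finset δ) (dc : δ → ℝ) (V : δ → FermionOp Λ')
    {κ'' : Type*} (w : Finset κ'') (a : κ'' → ℂ) (word : κ'' → List (Orb (PolySite Λ') × Bool)) {c : ℝ}
    (hcert : fermionEmbed (PolySite.incl h0) ((hubbardTTPrimeFermionInteraction t t' U).meanEnergyObs 1) -
        (c : ℂ) • (1 : FermionOp Λ') -
        ∑ σ : Fin 2, ((μ σ : ℝ) : ℂ) • (nAt 0 hz σ - ((ν : ℝ) : ℂ) • (1 : FermionOp Λ')) =
      gramForm Λm O +
        (∑ k ∈ s, ((hubbardTTPrimeFermionInteraction t t' U).localHamiltonian Λ' * fermionEmbed (PolySite.incl hΛ) (B k) -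
            fermionEmbed (PolySite.incl hΛ) (B k) * (hubbardTTPrimeFermionInteraction t t' U).localHamiltonian Λ') +
          ∑ l ∈ tt, (fermionEmbed (PolySite.incl (hsh l)) (fermionEmbed (PolySite.shiftEmb (v l) Λ) (Y l)) -
            fermionEmbed (PolySite.incl hΛ) (Y l)) +
          ∑ j ∈ u, b j • ladderWord (cw j)) +
        (∑ m' ∈ ah, ((dc m' : ℝ) : ℂ) • ((V m')ᴴ - V m') + ∑ k ∈ w, a k • ladderWord (word k))) :
    c - ∑ k ∈ w, ‖a k‖ + (∑ σ : Fin 2, μ σ) * (((nu : ℝ) + nd) / 2 / 15 - ν) ≤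
      (homHubbardSpinMagTT' crtHom53 κt t t' U).minEnergyOn (szSector (nu + nd) (((nu : ℝ) - nd) / 2)) / 15 := by
  have hInj' : Set.InjOn crtHom53 ↑Λ' :=
    injOn_ringHom_two_of_spread 15 ![6, 10] (M₀ := 4) (M₁ := 2)
      (fun a' b' h₁ h₂ h₃ h₄ h₅ => by
        simp only [Matrix.cons_val_zero, Matrix.cons_val_one] at h₅
        omega) hspread
  have hd : Function.Injective (signedHop crtHom53) := injective_signedHop_ringHom 15 ![6, 10] (by decide)
  have hd' : Function.Injective (signedHop (crtHom53.comp diagMap)) := by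
    rw [crtHom53_comp_diagMap]
    exact injective_signedHop_ringHom 15 ![16, -4] (by decide)
  have h := homTorusSpinTwistTT'_minEnergyOn_upDownSector_div_ge_of_window_certificate_avg crtHom53 t t' U κt hd hd'
    hnu hnd hΛ h8 h0 hz hInj' μ ν hΛm O s B tt v hsh Y u b cw hcw ah dc V w a word hcert
  simp only [Nat.cast_ofNat, pow_one] at h
  exact h

/-- **`5 × 3` `t–t'` torus (`crtHom53`) in SEAM form, every seam pair `η ∈ U(1)²`, every sector** — the
rows as computed: nearest-neighbour seam table `crtSeam 15 5 3 η` (phase `η₀` on the `x`-hops leaving the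
last column, `η₁` on the `y`-hops leaving the last row) and the induced diagonal table. Same data and
conclusion as `crt53SpinTwistTT'_minEnergyOn_upDownSector_div_ge_of_window_certificate`.
[cite: Gros1992] [cite: ShastrySutherland1990] [cite: Han2020Bootstrap, §3] [cite: XuEtAl2024, eq. (1)] -/
theorem crt53SeamTT'_minEnergyOn_upDownSector_div_ge_of_window_certificate (t t' U : ℝ) (η : Fin 2 → Circle)
    {nu nd : ℕ} (hnu : nu ≤ Fintype.card (FermionTorus 1 15)) (hnd : nd ≤ Fintype.card (FermionTorus 1 15))
    {Λ Λ' : Finset (Site 2)} (hΛ : Λ ⊆ Λ')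
    (hspread : ∀ x ∈ Λ', ∀ y ∈ Λ', |x 0 - y 0| ≤ (4 : ℤ) ∧ |x 1 - y 1| ≤ (2 : ℤ))
    (h8 : thicken Λ 1 ⊆ Λ') (h0 : thicken ({0} : Finset (Site 2)) 1 ⊆ Λ') (hz : (0 : Site 2) ∈ Λ')
    (μ : Fin 2 → ℝ) (ν : ℝ)
    {m : Type*} [Fintype m] [DecidableEq m] {Λm : Matrix m m ℂ} (hΛm : Λm.PosSemidef)
    (O : m → FermionOp Λ')
    {κ : Type*} (s : Finset κ) (B : κ → FermionOp Λ)
    {ι : Type*} (tt : Finset ι) (v : ι → Site 2) (hsh : ∀ l, shiftSet (v l) Λ ⊆ Λ') (Y : ι → FermionOp Λ)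
    {γ : Type*} (u : Finset γ) (b : γ → ℂ) (cw : γ → List (Orb (PolySite Λ') × Bool))
    (hcw : ∀ j ∈ u, ladderCharge (cw j) ≠ 0 ∨ ladderSpinCharge (cw j) ≠ 0)
    {δ : Type*} (ah : Finset δ) (dc : δ → ℝ) (V : δ → FermionOp Λ')
    {κ'' : Type*} (w : Finset κ'') (a : κ'' → ℂ) (word : κ'' → List (Orb (PolySite Λ') × Bool)) {c : ℝ}
    (hcert : fermionEmbed (PolySite.incl h0) ((hubbardTTPrimeFermionInteraction t t' U).meanEnergyObs 1) -
        (c : ℂ) • (1 : FermionOp Λ') -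
        ∑ σ : Fin 2, ((μ σ : ℝ) : ℂ) • (nAt 0 hz σ - ((ν : ℝ) : ℂ) • (1 : FermionOp Λ')) =
      gramForm Λm O +
        (∑ k ∈ s, ((hubbardTTPrimeFermionInteraction t t' U).localHamiltonian Λ' * fermionEmbed (PolySite.incl hΛ) (B k) -
            fermionEmbed (PolySite.incl hΛ) (B k) * (hubbardTTPrimeFermionInteraction t t' U).localHamiltonian Λ') +
          ∑ l ∈ tt, (fermionEmbed (PolySite.incl (hsh l)) (fermionEmbed (PolySite.shiftEmb (v l) Λ) (Y l)) -
            fermionEmbed (PolySite.incl hΛ) (Y l)) +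
          ∑ j ∈ u, b j • ladderWord (cw j)) +
        (∑ m' ∈ ah, ((dc m' : ℝ) : ℂ) • ((V m')ᴴ - V m') + ∑ k ∈ w, a k • ladderWord (word k))) :
    c - ∑ k ∈ w, ‖a k‖ + (∑ σ : Fin 2, μ σ) * (((nu : ℝ) + nd) / 2 / 15 - ν) ≤
      (homHubbardSpinMagTT'Gen crtHom53 (fun x i _ => crtSeam 15 5 3 η x i)
          (diagPathTable crtHom53 (fun x i _ => crtSeam 15 5 3 η x i)) t t' U).minEnergyOn
        (szSector (nu + nd) (((nu : ℝ) - nd) / 2)) / 15 := by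
  obtain ⟨κ', hκ⟩ := exists_pow_pair_eq_circle η (a := 5) (b := 3) (by norm_num) (by norm_num)
  have hseam : (fun (x : TorusSite 1 15) (i : Fin 2) (_ : Fin 2) => crtSeam 15 5 3 η x i) =
      homSpinGaugeTransform crtHom53 (fun x _ => crtGauge 15 5 3 κ' x) (fun _ i _ => κ' i) := by
    rw [← hκ, ← homGaugeTransform_crtGauge_crtHom53]
    rfl
  rw [hseam, minEnergyOn_szSector_homHubbardSpinMagTT'Gen_seam_gauge]
  exact crt53SpinTwistTT'_minEnergyOn_upDownSector_div_ge_of_window_certificate t t' U (fun i _ => κ' i) hnu hnd hΛ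
    hspread h8 h0 hz μ ν hΛm O s B tt v hsh Y u b cw hcw ah dc V w a word hcert

end CRTSpinTwistTTPrime

end Summit.Ventures.CertifiedManyBodySolver.Rows

end
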